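import Literature.NumberTheory.EllipticCurves.TwistFunctionalEquationModularityProofs
import Literature.NumberTheory.EllipticCurves.NonvanishingTwistsProofs
import Literature.NumberTheory.EllipticCurves.NonvanishingTwistsHoffsteinLuo
import Literature.NumberTheory.QuadraticFields.JacobiCharacterPrimitiveProofs
import HarnessLib

/-!
# Waldspurger's non-vanishing twist from Hoffstein–Luo's, via the sign of the functional equation

`Literature.NumberTheory.EllipticCurves.waldspurger_exists_heegnerField_twist_ne_zero` (Darmon 2004,
§3.9, proof of Thm. 3.22: `sign(E, ℚ) = −1` ⇒ infinitely many quadratic `ε` with `ε(ℓ) = 1` for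
`ℓ ∣ N`, `ε(−1) = −1`, `L(E, ε, 1) ≠ 0`) is here reduced to

* the Modularity Theorem `exists_isNewformOf` (Breuil–Conrad–Diamond–Taylor 2001, Thm. A);
* the tree's Hoffstein–Luo fact `HoffsteinLuo1997_exists_twist_L_one_ne_zero` (Hoffstein–Luo 1997,
  Theorem: for every `E/ℚ`, finite `S` and bound `B` a square-free `d ≡ 1 (mod 8)`, `|d| > B`, with
  `(d/p) = 1` for the odd `p ∈ S` and `L(E^{(d)}, 1) ≠ 0`) — which carries **no** hypothesis on the
  sign of `E` and does **not** specify the sign of `d`;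
* and the arithmetic of the twist by an odd fundamental discriminant `d > 0`, isolated as the one
  hypothesis `hcoeff` to be fed by the tree: `aₙ(E^{(d)}) = (n/d) aₙ(E)` for all `n ≥ 1` when
  `(d, N) = 1` (Silverman *AEC* X, Exercise 10.16; `L(E^{(d)}, s) = L(E ⊗ χ_d, s)` — the tree's
  `LFunction_quadraticTwist_pStar_apply` is the case `d = p*` away from `p`). The Kronecker character
  `χ_d = (·/d)` mod `d` is the tree's `jacobiChar d` (`QuadraticFields/JacobiCharacter.lean`), a
  primitive quadratic Dirichlet character (`isPrimitive_jacobiChar`, `isQuadratic_jacobiChar`).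

The bridge is the **sign of the functional equation of the twist** (Murty–Murty 1997, Ch. 6, §1 and
p. 96: `w(E ⊗ χ_D) = ω χ_D(−N)`, "`(1 − ω χ_D(−N)) L_D(1, f) = 0` … the requirement that
`L_D(1, f) ≠ 0` imposes a condition on `D`"; proved from modularity in
`TwistFunctionalEquationModularityProofs`): if `w(E) = −1` and `d > 0` with `(d/ℓ) = 1` for all
`ℓ ∣ N`, then `χ_d(−1) χ_d(N) = 1`, the sign of `L(E^{(d)}, s)` is `−1` and `L(E^{(d)}, 1) = 0`
(`entireLFunction_one_eq_zero_of_twist_sign`). So Hoffstein–Luo's `d` (taken with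
`S = ` the primes dividing `N`) is negative — Darmon's condition (2), `ε(−1) = −1` — and `K = ℚ(√d)`
is an imaginary quadratic field of discriminant `d` in which every `ℓ ∣ N` splits
(`waldspurger_exists_heegnerField_twist_ne_zero_iff_fundamental`).

Main result: `waldspurger_exists_heegnerField_twist_ne_zero_of_hoffsteinLuo_of_twistCoeff`.
Everything here is proved; no named facts are introduced (D-0026).

## References

* [Darmon2004] H. Darmon, *Rational points on modular elliptic curves*, CBMS 101 (2004), §3.9,
  proof of Thm. 3.22, (1)–(3).
* [HoffsteinLuo1997] J. Hoffstein, W. Luo, *Nonvanishing of `L`-series and the combinatorial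
  sieve*, Math. Res. Lett. 4 (1997), Theorem (pp. 435–436).
* [MurtyMurty1997] M. R. Murty, V. K. Murty, *Non-vanishing of `L`-functions and applications*,
  Birkhäuser (1997), Ch. 6, §1 and p. 96.
* [IrelandRosen1990] K. Ireland, M. Rosen, *A classical introduction to modern number theory*,
  2nd ed., §5.2 (Jacobi symbol, reciprocity), §20.5.
-/

noncomputable section

open scoped Classical

open WeierstrassCurve Literature.NumberTheory.EllipticCurves.ModularForms

namespace Literature.NumberTheory.EllipticCurves

/-! ### Arithmetic of `d`: coprimality to `N`, and `χ_d(−1) = 1` for `d > 0` -/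

/-- `(−1/m) = 1` for `m ≡ 1 (mod 4)`: the Kronecker character `χ_d = (·/d)` of a positive odd
fundamental discriminant `d` is even (first supplement, `jacobiSym.at_neg_one`: `(−1/m) = χ₄(m)`;
Ireland–Rosen Prop. 5.2.2). [cite: IrelandRosen1990, Prop. 5.2.2] -/
theorem jacobiChar_neg_one_of_mod_four_eq_one {m : ℕ} [NeZero m] (hm : m % 4 = 1) :
    QuadraticFields.jacobiChar m (-1) = 1 := by
  have hodd : Odd m := Nat.odd_iff.mpr (by omega)
  have h := QuadraticFields.jacobiChar_intCast (q := m) (-1)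
  rw [Int.cast_neg, Int.cast_one] at h
  rw [h, jacobiSym.at_neg_one hodd, ZMod.χ₄_nat_one_mod_four hm, Int.cast_one]

/-- For `d` square-free and odd with `(d/p) = 1` for every odd prime `p ∣ N`, `d` is prime to `N`.
[folklore] -/
theorem int_gcd_eq_one_of_forall_jacobiSym_eq_one {d : ℤ} (hd2 : ¬ (2 : ℤ) ∣ d) {N : ℕ}
    (h : ∀ p : ℕ, p.Prime → p ∣ N → p ≠ 2 → jacobiSym d p = 1) : Int.gcd d N = 1 := by
  by_contra hg
  obtain ⟨p, hp, hpg⟩ := Nat.exists_prime_and_dvd hg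
  have hpd : (p : ℤ) ∣ d := Int.natCast_dvd.mpr (hpg.trans (Int.gcd_dvd_natAbs_left d N))
  have hpN : p ∣ N := by
    have := hpg.trans (Int.gcd_dvd_natAbs_right d N)
    simpa using this
  by_cases hp2 : p = 2
  · subst hp2
    exact hd2 (by exact_mod_cast hpd)
  · have h1 := h p hp hpN hp2
    haveI := Fact.mk hp
    have h0 : jacobiSym d p = 0 := by
      rw [jacobiSym.eq_zero_iff]
      refine ⟨hp.ne_zero, fun hc ↦ ?_⟩
      have : p ∣ 1 := by
        have := Int.dvd_gcd hpd (dvd_refl (p : ℤ))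
        rwa [show Int.gcd d p = 1 from hc] at this
      exact hp.one_lt.ne' (Nat.dvd_one.mp this)
    rw [h0] at h1
    exact zero_ne_one h1

/-! ### The reduction -/

/-- **Waldspurger's non-vanishing twist (Darmon 2004, §3.9, (1)–(3)) from Modularity, Hoffstein–Luo,
and the arithmetic of odd positive twists.** Assume:

* `hmod`: the Modularity Theorem `exists_isNewformOf`;
* `hHL`: Hoffstein–Luo 1997, Theorem, in the tree's form `HoffsteinLuo1997_exists_twist_L_one_ne_zero`;
* `hcoeff`: for `E/ℚ` elliptic and `d > 0` square-free, `d ≡ 1 (mod 4)`, prime to `N_E`, the twist has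
  `aₙ(E^{(d)}) = (n/d) aₙ(E)` for all `n ≥ 1` (Silverman *AEC* X, Exercise 10.16; `L(E^{(d)}, s) =
  L(E ⊗ χ_d, s)`).

Then `waldspurger_exists_heegnerField_twist_ne_zero` holds. Proof: for `w(E) = −1` and a bound `B`,
Hoffstein–Luo (with `S` the set of primes dividing `N_E`) gives a square-free `d ≡ 1 (mod 8)`,
`|d| > max B 1`, `(d/ℓ) = 1` for all odd `ℓ ∣ N_E`, `L(E^{(d)}, 1) ≠ 0`. If `d > 0`, then
`(−1/d) = 1` and `(N_E/d) = 1` (`jacobiChar_natAbs_natCast_eq_one_of_forall_prime`: the primes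
`ℓ ∣ N_E` "split"), so, for the primitive quadratic character `χ_d = jacobiChar d`, the functional
equation of `L(E^{(d)}, s)` has sign `w(E) χ_d(−1) χ_d(N_E) = −1` and `L(E^{(d)}, 1) = 0`
(`entireLFunction_one_eq_zero_of_twist_sign`; Murty–Murty 1997, Ch. 6, p. 96), a contradiction.
Hence `d < 0` is a negative fundamental discriminant with `(d/ℓ) = 1` for all `ℓ ∣ N_E`, which is the
fundamental-discriminant form of the fact (`waldspurger_exists_heegnerField_twist_ne_zero_iff_fundamental`).
[cite: Darmon2004, §3.9, proof of Thm. 3.22, (1)–(3)] [cite: HoffsteinLuo1997, Theorem (§1, pp. 435–436)]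
[cite: MurtyMurty1997, Ch. 6 §1, p. 96] -/
theorem waldspurger_exists_heegnerField_twist_ne_zero_of_hoffsteinLuo_of_twistCoeff
    (hmod : exists_isNewformOf) (hHL : HoffsteinLuo1997_exists_twist_L_one_ne_zero)
    (hcoeff : ∀ (W : WeierstrassCurve ℚ) [W.IsElliptic] (d : ℤ), 0 < d → Squarefree d → d % 4 = 1 →
      Int.gcd d (W.conductorNorm ℤ) = 1 →
        ∀ n : ℕ, ((W.quadraticTwist (d : ℚ)).LFunction n : ℂ) =
          jacobiSym n d.natAbs * (W.LFunction n : ℂ)) :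
    waldspurger_exists_heegnerField_twist_ne_zero := by
  rw [waldspurger_exists_heegnerField_twist_ne_zero_iff_fundamental]
  intro W _ hw B
  set N : ℕ := W.conductorNorm ℤ with hN
  have hN0 : N ≠ 0 := (W.conductorNorm_pos_holds).ne'
  obtain ⟨d, hBd, hsq, hd8, -, hjac, hL⟩ := hHL W N.primeFactors (max B 1)
  have hjac' : ∀ p : ℕ, p.Prime → p ∣ N → p ≠ 2 → jacobiSym d p = 1 := fun p hp hpN hp2 ↦
    hjac p (Nat.mem_primeFactors.mpr ⟨hp, hpN, hN0⟩) hp hp2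
  have hd4 : d % 4 = 1 := by omega
  have hd2 : ¬ (2 : ℤ) ∣ d := by omega
  have hd1 : d ≠ 1 := by
    rintro rfl
    simp at hBd
  have hB : B < d.natAbs := lt_of_le_of_lt (le_max_left B 1) hBd
  have hgcd : Int.gcd d N = 1 := int_gcd_eq_one_of_forall_jacobiSym_eq_one hd2 hjac'
  -- the sign argument: `d > 0` is impossible
  have hdneg : d < 0 := by
    by_contra hd0
    push Not at hd0
    have hd0' : 0 < d := lt_of_le_of_ne hd0 (Ne.symm hsq.ne_zero)
    have hmd : (d.natAbs : ℤ) = d := Int.natAbs_of_nonneg hd0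
    haveI : NeZero d.natAbs := ⟨Int.natAbs_ne_zero.mpr hsq.ne_zero⟩
    have hm4 : d.natAbs % 4 = 1 := by omega
    have hmodd : Odd d.natAbs := Nat.odd_iff.mpr (by omega)
    have hmsq : Squarefree d.natAbs := Int.squarefree_natAbs.mpr hsq
    have hNm : N.Coprime d.natAbs := by
      rw [Nat.Coprime, Nat.gcd_comm]
      simpa [Int.gcd] using hgcd
    have hco : ∀ n : ℕ, ((W.quadraticTwist (d : ℚ)).LFunction n : ℂ) =
        QuadraticFields.jacobiChar d.natAbs n * (W.LFunction n : ℂ) := fun n ↦ by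
      rw [hcoeff W d hd0' hsq hd4 hgcd n, QuadraticFields.jacobiChar_natCast]
    have hχN : QuadraticFields.jacobiChar d.natAbs N = 1 :=
      QuadraticFields.jacobiChar_natAbs_natCast_eq_one_of_forall_prime hd4 hN0
        fun p hp hpN ↦ ⟨fun _ ↦ hd8, fun hp2 ↦ hjac' p hp hpN hp2⟩
    have hsign : (W.rootNumber : ℂ) * QuadraticFields.jacobiChar d.natAbs (-1) *
        QuadraticFields.jacobiChar d.natAbs N = -1 := by
      rw [hw, jacobiChar_neg_one_of_mod_four_eq_one hm4, hχN]
      push_cast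
      ring
    exact hL (entireLFunction_one_eq_zero_of_twist_sign W hmod hNm
      QuadraticFields.isQuadratic_jacobiChar (QuadraticFields.isPrimitive_jacobiChar hmodd hmsq)
      (W.quadraticTwist (d : ℚ)) hco hsign)
  exact ⟨d, hdneg, Or.inl ⟨hd4, hsq, hd1⟩, hB,
    fun p hp hpN ↦ ⟨fun _ ↦ hd8, fun hp2 ↦ hjac' p hp hpN hp2⟩, hL⟩

end Literature.NumberTheory.EllipticCurves

end
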